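import Literature.Topology.FourManifolds.TubularNbhdConeTube
import HarnessLib

/-!
# Reframing a tubular neighbourhood of a knot by a loop of oriented linear maps of the fibre

Topic `Literature/Topology/FourManifolds`; infrastructure for the named fact
`Literature.Topology.FourManifolds.Knot.IsSliceDisc.exists_conicalTube_hasFraming_zero`
(`SliceDiscEndCollarFacts.lean`), the open leaf under Manolescu–Piccirillo (2023), Lemma 3.3 for
`W = S⁴`. The conical tube of a slice disc (`SliceDiscConicalTube.lean`) wants a transversal framing of
the disc which over the boundary band is the cone on the fibre derivative of *some* oriented tubular
neighbourhood `ν` of the knot; a global frame of the normal bundle of the disc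
(`NormalFrameTransport.lean`) induces on the boundary circle a normal framing of the knot which is in
general *not* the fibre derivative of a given `ν₀` — the two differ by a loop of invertible `2 × 2`
matrices (the change of trivialisation of the normal bundle of the knot; Gompf–Stipsicz, *4-Manifolds
and Kirby Calculus* (1999), §4.5: the framings of a knot form a `ℤ`-torsor). This file proves that
**precomposing `ν₀` with any smooth loop of orientation-preserving linear maps of the fibre is again an
oriented tubular neighbourhood** (`Knot.TubularNbhd.reframe`, generalising the rotations
`Knot.TubularNbhd.twist` of `DehnSurgeryTwistProofs.lean`), and computes its fibre derivative along
the zero section (`fderiv_reframe_fibre`). Everything is proved; no named facts.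

* `FibreReframe`: four `C^∞` functions `a b c d : 𝕊¹ → ℝ` with `a d - b c > 0`; `R.lin u` is the
  linear map `w ↦ (a w₀ + b w₁, c w₀ + d w₁)` of `ℝ²`, `R.inv u` its inverse, `R.diffeo` the
  diffeomorphism `(u, w) ↦ (u, R.lin u w)` of `𝕊¹ × ℝ²`.
* `Knot.TubularNbhd.reframe ν R = ν ∘ R.diffeo`: a smooth embedding (the tree's
  `Manifold.IsSmoothEmbedding.comp_diffeomorph`) with zero section `K` and positively oriented — in
  the coordinates of `det_pos` its Jacobian frame at `(θ, w)` is that of `ν` at `(θ, R.lin w)` with the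
  fibre rows transformed by the matrix (determinant `a d - b c > 0`, `frameDet_comb₂`) and a combination
  of them added to the `θ`-row (`frameDet_row_add`).

## References

* R. E. Gompf, A. I. Stipsicz, *4-Manifolds and Kirby Calculus*, GSM 20 (1999), §4.5.
  [cite: GompfStipsicz1999, §4.5]
* M. W. Hirsch, *Differential Topology* (1976), Ch. 4 §5 (tubular neighbourhoods and their
  trivialisations). [cite: Hirsch1976, §4.5 Thm 5.2]

## Design notes

* The loop is given by functions on `𝕊¹` (not `2π`-periodic functions of the angle), `ContMDiff` for
  `𝓡 1`; consumers restrict smooth functions of `ℝ² ∖ 0` to the circle.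
* No `sorry`, no instances beyond the local finite-dimensionality facts of the sibling files.
-/

noncomputable section

open Set Metric Function Filter
open scoped Manifold ContDiff Topology

namespace Literature.Topology.FourManifolds

/-- Local notation: `𝔼 n` is the model Euclidean space `EuclideanSpace ℝ (Fin n)`. -/
local notation "𝔼 " n:arg => EuclideanSpace ℝ (Fin n)

/-- Local notation: `𝕊 n` is the unit sphere in `EuclideanSpace ℝ (Fin (n + 1))`. -/
local notation "𝕊 " n:arg => (Metric.sphere (0 : EuclideanSpace ℝ (Fin (n + 1))) 1)

/-- Local notation: the model with corners of `𝕊¹ × ℝ²`. -/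
local notation "𝓘₁₂" => (ModelWithCorners.prod (𝓡 1) 𝓘(ℝ, EuclideanSpace ℝ (Fin 2)))

attribute [local instance] fact_finrank_euclideanSpace_two fact_finrank_euclideanSpace_four

/-! ### Loops of oriented linear maps of the plane -/

/-- **A smooth loop of orientation-preserving linear maps of `ℝ²`**, given by its matrix entries
`a b c d : 𝕊¹ → ℝ` (`C^∞`) with `a d - b c > 0` (a change of trivialisation of the oriented normal
bundle of a knot; Gompf–Stipsicz (1999), §4.5). [cite: GompfStipsicz1999, §4.5] -/
structure FibreReframe where
  /-- the `(0,0)` entry -/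
  a : 𝕊 1 → ℝ
  /-- the `(0,1)` entry -/
  b : 𝕊 1 → ℝ
  /-- the `(1,0)` entry -/
  c : 𝕊 1 → ℝ
  /-- the `(1,1)` entry -/
  d : 𝕊 1 → ℝ
  contMDiff_a : ContMDiff (𝓡 1) 𝓘(ℝ, ℝ) ∞ a
  contMDiff_b : ContMDiff (𝓡 1) 𝓘(ℝ, ℝ) ∞ b
  contMDiff_c : ContMDiff (𝓡 1) 𝓘(ℝ, ℝ) ∞ c
  contMDiff_d : ContMDiff (𝓡 1) 𝓘(ℝ, ℝ) ∞ d
  det_pos : ∀ u, 0 < a u * d u - b u * c u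

namespace FibreReframe

variable (R : FibreReframe)

/-- The determinant `a d - b c` of the loop at `u`. [folklore] -/
def det (u : 𝕊 1) : ℝ := R.a u * R.d u - R.b u * R.c u

/-- The determinant is positive. [folklore] -/
theorem det_pos' (u : 𝕊 1) : 0 < R.det u := R.det_pos u

/-- The determinant is nonzero. [folklore] -/
theorem det_ne_zero (u : 𝕊 1) : R.det u ≠ 0 := (R.det_pos u).ne'

/-- **The linear map `w ↦ (a w₀ + b w₁, c w₀ + d w₁)`** of the fibre over `u`. [folklore] -/
def lin (u : 𝕊 1) (w : 𝔼 2) : 𝔼 2 := !₂[R.a u * w 0 + R.b u * w 1, R.c u * w 0 + R.d u * w 1]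

/-- First coordinate of `lin`. [folklore] -/
@[simp] theorem lin_apply_zero (u : 𝕊 1) (w : 𝔼 2) : R.lin u w 0 = R.a u * w 0 + R.b u * w 1 := rfl

/-- Second coordinate of `lin`. [folklore] -/
@[simp] theorem lin_apply_one (u : 𝕊 1) (w : 𝔼 2) : R.lin u w 1 = R.c u * w 0 + R.d u * w 1 := rfl

/-- **The inverse linear map** of the fibre over `u`. [folklore] -/
def inv (u : 𝕊 1) (w : 𝔼 2) : 𝔼 2 :=
  !₂[(R.det u)⁻¹ * (R.d u * w 0 - R.b u * w 1), (R.det u)⁻¹ * (-R.c u * w 0 + R.a u * w 1)]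

/-- First coordinate of `inv`. [folklore] -/
@[simp] theorem inv_apply_zero (u : 𝕊 1) (w : 𝔼 2) :
    R.inv u w 0 = (R.det u)⁻¹ * (R.d u * w 0 - R.b u * w 1) := rfl

/-- Second coordinate of `inv`. [folklore] -/
@[simp] theorem inv_apply_one (u : 𝕊 1) (w : 𝔼 2) :
    R.inv u w 1 = (R.det u)⁻¹ * (-R.c u * w 0 + R.a u * w 1) := rfl

/-- `lin u` is additive. [folklore] -/
theorem lin_add (u : 𝕊 1) (w w' : 𝔼 2) : R.lin u (w + w') = R.lin u w + R.lin u w' := by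
  ext i; fin_cases i <;> simp <;> ring

/-- `lin u` is homogeneous. [folklore] -/
theorem lin_smul (u : 𝕊 1) (r : ℝ) (w : 𝔼 2) : R.lin u (r • w) = r • R.lin u w := by
  ext i; fin_cases i <;> simp <;> ring

/-- `lin u 0 = 0`. [folklore] -/
@[simp] theorem lin_zero (u : 𝕊 1) : R.lin u 0 = 0 := by
  ext i; fin_cases i <;> simp

/-- First coordinate of `inv u (lin u w)`. [folklore] -/
theorem inv_lin_apply_zero (u : 𝕊 1) (w : 𝔼 2) : R.inv u (R.lin u w) 0 = w 0 := by
  change (R.det u)⁻¹ * (R.d u * (R.a u * w 0 + R.b u * w 1) - R.b u * (R.c u * w 0 + R.d u * w 1)) = w 0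
  rw [show R.d u * (R.a u * w 0 + R.b u * w 1) - R.b u * (R.c u * w 0 + R.d u * w 1) = R.det u * w 0 by
    simp only [FibreReframe.det]; ring, ← mul_assoc, inv_mul_cancel₀ (R.det_ne_zero u), one_mul]

/-- Second coordinate of `inv u (lin u w)`. [folklore] -/
theorem inv_lin_apply_one (u : 𝕊 1) (w : 𝔼 2) : R.inv u (R.lin u w) 1 = w 1 := by
  change (R.det u)⁻¹ * (-R.c u * (R.a u * w 0 + R.b u * w 1) + R.a u * (R.c u * w 0 + R.d u * w 1)) = w 1
  rw [show -R.c u * (R.a u * w 0 + R.b u * w 1) + R.a u * (R.c u * w 0 + R.d u * w 1) = R.det u * w 1 by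
    simp only [FibreReframe.det]; ring, ← mul_assoc, inv_mul_cancel₀ (R.det_ne_zero u), one_mul]

/-- First coordinate of `lin u (inv u w)`. [folklore] -/
theorem lin_inv_apply_zero (u : 𝕊 1) (w : 𝔼 2) : R.lin u (R.inv u w) 0 = w 0 := by
  change R.a u * ((R.det u)⁻¹ * (R.d u * w 0 - R.b u * w 1)) +
      R.b u * ((R.det u)⁻¹ * (-R.c u * w 0 + R.a u * w 1)) = w 0
  rw [show R.a u * ((R.det u)⁻¹ * (R.d u * w 0 - R.b u * w 1)) +
      R.b u * ((R.det u)⁻¹ * (-R.c u * w 0 + R.a u * w 1)) = (R.det u)⁻¹ * (R.det u * w 0) by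
    simp only [FibreReframe.det]; ring, ← mul_assoc, inv_mul_cancel₀ (R.det_ne_zero u), one_mul]

/-- Second coordinate of `lin u (inv u w)`. [folklore] -/
theorem lin_inv_apply_one (u : 𝕊 1) (w : 𝔼 2) : R.lin u (R.inv u w) 1 = w 1 := by
  change R.c u * ((R.det u)⁻¹ * (R.d u * w 0 - R.b u * w 1)) +
      R.d u * ((R.det u)⁻¹ * (-R.c u * w 0 + R.a u * w 1)) = w 1
  rw [show R.c u * ((R.det u)⁻¹ * (R.d u * w 0 - R.b u * w 1)) +
      R.d u * ((R.det u)⁻¹ * (-R.c u * w 0 + R.a u * w 1)) = (R.det u)⁻¹ * (R.det u * w 1) by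
    simp only [FibreReframe.det]; ring, ← mul_assoc, inv_mul_cancel₀ (R.det_ne_zero u), one_mul]

/-- `inv u` undoes `lin u`. [folklore] -/
theorem inv_lin (u : 𝕊 1) (w : 𝔼 2) : R.inv u (R.lin u w) = w := by
  ext i; fin_cases i
  · exact R.inv_lin_apply_zero u w
  · exact R.inv_lin_apply_one u w

/-- `lin u` undoes `inv u`. [folklore] -/
theorem lin_inv (u : 𝕊 1) (w : 𝔼 2) : R.lin u (R.inv u w) = w := by
  ext i; fin_cases i
  · exact R.lin_inv_apply_zero u w
  · exact R.lin_inv_apply_one u w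

/-- `lin u` as a continuous linear map. [folklore] -/
def linCLM (u : 𝕊 1) : 𝔼 2 →L[ℝ] 𝔼 2 :=
  LinearMap.toContinuousLinearMap
    { toFun := R.lin u
      map_add' := R.lin_add u
      map_smul' := fun r w ↦ R.lin_smul u r w }

/-- The continuous linear map is `lin u`. [folklore] -/
@[simp] theorem linCLM_apply (u : 𝕊 1) (w : 𝔼 2) : R.linCLM u w = R.lin u w := rfl

/-- `lin` in "sum of coordinate functions times basis vectors" form. [folklore] -/
theorem lin_eq_smul_add (u : 𝕊 1) (w : 𝔼 2) :
    R.lin u w = (R.a u * w 0 + R.b u * w 1) • EuclideanSpace.single 0 (1 : ℝ) +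
      (R.c u * w 0 + R.d u * w 1) • EuclideanSpace.single 1 (1 : ℝ) := by
  ext i; fin_cases i <;> simp

/-- `inv` in "sum of coordinate functions times basis vectors" form. [folklore] -/
theorem inv_eq_smul_add (u : 𝕊 1) (w : 𝔼 2) :
    R.inv u w = ((R.det u)⁻¹ * (R.d u * w 0 - R.b u * w 1)) • EuclideanSpace.single 0 (1 : ℝ) +
      ((R.det u)⁻¹ * (-R.c u * w 0 + R.a u * w 1)) • EuclideanSpace.single 1 (1 : ℝ) := by
  ext i; fin_cases i <;> simp

/-- The coordinate `w ↦ w i` on `𝕊¹ × ℝ²` is smooth. [folklore] -/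
theorem contMDiff_snd_coord (i : Fin 2) :
    ContMDiff 𝓘₁₂ 𝓘(ℝ, ℝ) ∞ fun p : (𝕊 1) × 𝔼 2 ↦ p.2 i :=
  ((EuclideanSpace.proj i : 𝔼 2 →L[ℝ] ℝ).contMDiff).comp contMDiff_snd

/-- The determinant is a smooth function on the circle. [folklore] -/
theorem contMDiff_det : ContMDiff (𝓡 1) 𝓘(ℝ, ℝ) ∞ R.det :=
  (R.contMDiff_a.mul R.contMDiff_d).sub (R.contMDiff_b.mul R.contMDiff_c)

/-- **`(u, w) ↦ lin u w` is smooth on `𝕊¹ × ℝ²`.** [folklore] -/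
theorem contMDiff_lin : ContMDiff 𝓘₁₂ 𝓘(ℝ, 𝔼 2) ∞ fun p : (𝕊 1) × 𝔼 2 ↦ R.lin p.1 p.2 := by
  have hfst : ContMDiff 𝓘₁₂ (𝓡 1) ∞ (Prod.fst : (𝕊 1) × 𝔼 2 → 𝕊 1) := contMDiff_fst
  have ha := R.contMDiff_a.comp hfst
  have hb := R.contMDiff_b.comp hfst
  have hc := R.contMDiff_c.comp hfst
  have hd := R.contMDiff_d.comp hfst
  have h0 := contMDiff_snd_coord 0
  have h1 := contMDiff_snd_coord 1
  have key : (fun p : (𝕊 1) × 𝔼 2 ↦ R.lin p.1 p.2) = fun p ↦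
      (R.a p.1 * p.2 0 + R.b p.1 * p.2 1) • EuclideanSpace.single 0 (1 : ℝ) +
        (R.c p.1 * p.2 0 + R.d p.1 * p.2 1) • EuclideanSpace.single 1 (1 : ℝ) :=
    funext fun p ↦ R.lin_eq_smul_add p.1 p.2
  rw [key]
  exact (((ha.mul h0).add (hb.mul h1)).smul contMDiff_const).add
    (((hc.mul h0).add (hd.mul h1)).smul contMDiff_const)

/-- **`(u, w) ↦ inv u w` is smooth on `𝕊¹ × ℝ²`.** [folklore] -/
theorem contMDiff_inv : ContMDiff 𝓘₁₂ 𝓘(ℝ, 𝔼 2) ∞ fun p : (𝕊 1) × 𝔼 2 ↦ R.inv p.1 p.2 := by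
  have hfst : ContMDiff 𝓘₁₂ (𝓡 1) ∞ (Prod.fst : (𝕊 1) × 𝔼 2 → 𝕊 1) := contMDiff_fst
  have ha := R.contMDiff_a.comp hfst
  have hb := R.contMDiff_b.comp hfst
  have hc := R.contMDiff_c.comp hfst
  have hd := R.contMDiff_d.comp hfst
  have hdet : ContMDiff 𝓘₁₂ 𝓘(ℝ, ℝ) ∞ fun p : (𝕊 1) × 𝔼 2 ↦ (R.det p.1)⁻¹ :=
    (R.contMDiff_det.comp hfst).inv₀ fun p ↦ R.det_ne_zero p.1
  have h0 := contMDiff_snd_coord 0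
  have h1 := contMDiff_snd_coord 1
  have key : (fun p : (𝕊 1) × 𝔼 2 ↦ R.inv p.1 p.2) = fun p ↦
      ((R.det p.1)⁻¹ * (R.d p.1 * p.2 0 - R.b p.1 * p.2 1)) • EuclideanSpace.single 0 (1 : ℝ) +
        ((R.det p.1)⁻¹ * (-R.c p.1 * p.2 0 + R.a p.1 * p.2 1)) • EuclideanSpace.single 1 (1 : ℝ) :=
    funext fun p ↦ R.inv_eq_smul_add p.1 p.2
  rw [key]
  exact ((hdet.mul ((hd.mul h0).sub (hb.mul h1))).smul contMDiff_const).add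
    ((hdet.mul ((hc.neg.mul h0).add (ha.mul h1))).smul contMDiff_const)

/-- **The reframing diffeomorphism `(u, w) ↦ (u, lin u w)` of `𝕊¹ × ℝ²`.** [folklore] -/
def diffeo : ((𝕊 1) × 𝔼 2) ≃ₘ⟮𝓘₁₂, 𝓘₁₂⟯ ((𝕊 1) × 𝔼 2) where
  toFun p := (p.1, R.lin p.1 p.2)
  invFun p := (p.1, R.inv p.1 p.2)
  left_inv p := Prod.ext rfl (R.inv_lin p.1 p.2)
  right_inv p := Prod.ext rfl (R.lin_inv p.1 p.2)
  contMDiff_toFun := contMDiff_fst.prodMk R.contMDiff_lin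
  contMDiff_invFun := contMDiff_fst.prodMk R.contMDiff_inv

/-- The reframing diffeomorphism on points. [folklore] -/
@[simp] theorem diffeo_apply (p : (𝕊 1) × 𝔼 2) : R.diffeo p = (p.1, R.lin p.1 p.2) := rfl

/-- **The matrix entries are smooth functions of the angle.** [folklore] -/
theorem contDiff_comp_circlePoint {f : 𝕊 1 → ℝ} (hf : ContMDiff (𝓡 1) 𝓘(ℝ, ℝ) ∞ f) :
    ContDiff ℝ ∞ fun t : ℝ ↦ f (circlePoint t) :=
  contMDiff_iff_contDiff.1 (hf.comp contMDiff_circlePoint)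

/-- **The fibre curve `t ↦ lin (circlePoint t) w` is differentiable**, with some velocity. [folklore] -/
theorem hasDerivAt_lin_circlePoint (θ : ℝ) (w : 𝔼 2) :
    HasDerivAt (fun t : ℝ ↦ R.lin (circlePoint t) w)
      (deriv (fun t : ℝ ↦ R.lin (circlePoint t) w) θ) θ := by
  have h : (fun t : ℝ ↦ R.lin (circlePoint t) w) = fun t ↦
      (R.a (circlePoint t) * w 0 + R.b (circlePoint t) * w 1) • EuclideanSpace.single 0 (1 : ℝ) +
        (R.c (circlePoint t) * w 0 + R.d (circlePoint t) * w 1) • EuclideanSpace.single 1 (1 : ℝ) :=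
    funext fun t ↦ R.lin_eq_smul_add _ _
  have hdiff : Differentiable ℝ fun t : ℝ ↦ R.lin (circlePoint t) w := by
    rw [h]
    have ha := (contDiff_comp_circlePoint R.contMDiff_a).differentiable (by simp)
    have hb := (contDiff_comp_circlePoint R.contMDiff_b).differentiable (by simp)
    have hc := (contDiff_comp_circlePoint R.contMDiff_c).differentiable (by simp)
    have hd := (contDiff_comp_circlePoint R.contMDiff_d).differentiable (by simp)
    exact (((ha.mul (differentiable_const _)).add (hb.mul (differentiable_const _))).smul_const _).add
      (((hc.mul (differentiable_const _)).add (hd.mul (differentiable_const _))).smul_const _)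
  exact (hdiff θ).hasDerivAt

end FibreReframe

/-! ### The reframed tubular neighbourhood -/

namespace Knot.TubularNbhd

variable {K : 𝕊 1 → 𝕊 3} (ν : Knot.TubularNbhd K)

/-- **Derivative of the coordinate expression along a curve `t ↦ (t, c t)`** (chain rule):
`L (1, 0) + L (0, c' θ)`. [folklore] -/
theorem deriv_coordMap_curve {c : ℝ → 𝔼 2} {θ : ℝ} {v : 𝔼 2} (hc : HasDerivAt c v θ) :
    deriv (fun t : ℝ ↦ ν.coordMap (t, c t)) θ =
      fderiv ℝ ν.coordMap (θ, c θ) (1, 0) + fderiv ℝ ν.coordMap (θ, c θ) (0, v) := by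
  set γ : ℝ → ℝ × 𝔼 2 := fun t ↦ (t, c t) with hγ
  have hγ' : HasDerivAt γ ((1 : ℝ), v) θ := (hasDerivAt_id θ).prodMk hc
  have hγθ : γ θ = (θ, c θ) := rfl
  have hG : HasFDerivAt ν.coordMap (fderiv ℝ ν.coordMap (γ θ)) (γ θ) :=
    (ν.differentiable_coordMap _).hasFDerivAt
  have h := (hG.comp_hasDerivAt θ hγ').deriv
  change deriv (ν.coordMap ∘ γ) θ = _
  rw [h, hγθ, ← map_add]
  congr 1
  ext <;> simp

variable (R : FibreReframe)

/-- **The reframed tubular neighbourhood `ν ∘ R.diffeo`**: `(u, w) ↦ ν (u, R.lin u w)`. It is again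
an oriented tubular neighbourhood of the same knot — a smooth embedding extending `K` on the zero
section and positively oriented: its Jacobian frame at `(θ, w)` is the frame of `ν` at
`(θ, R.lin w)` with the two fibre rows transformed by the matrix of `R` at `circlePoint θ`
(determinant `a d - b c > 0`) and a combination of them added to the `θ`-row (compare
`Knot.TubularNbhd.twist`, the case of the rotations `R_{±θ}`). Gompf–Stipsicz (1999), §4.5.
[cite: GompfStipsicz1999, §4.5] -/
def reframe : Knot.TubularNbhd K where
  toFun p := ν (p.1, R.lin p.1 p.2)
  isSmoothEmbedding := by
    have : (fun p : (𝕊 1) × 𝔼 2 ↦ ν (p.1, R.lin p.1 p.2)) = ⇑ν ∘ R.diffeo := by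
      funext p; rfl
    rw [this]
    exact ν.isSmoothEmbedding_coe.comp_diffeomorph R.diffeo
  apply_zero x := by
    change ν (x, R.lin x 0) = K x
    rw [R.lin_zero, ν.coe_apply_zero]
  det_pos θ w := by
    -- notation
    set G := ν.coordMap with hGdef
    set u : 𝕊 1 := circlePoint θ with hu
    set w' : 𝔼 2 := R.lin u w with hw'
    set L : ℝ × 𝔼 2 →L[ℝ] 𝔼 4 := fderiv ℝ G (θ, w') with hL
    set e₀ : 𝔼 2 := EuclideanSpace.single 0 (1 : ℝ) with he₀
    set e₁ : 𝔼 2 := EuclideanSpace.single 1 (1 : ℝ) with he₁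
    set v₁ : 𝔼 2 := deriv (fun t : ℝ ↦ R.lin (circlePoint t) w) θ with hv₁
    -- the three derivative rows
    have h1 : deriv (fun t : ℝ ↦ G (t, R.lin (circlePoint t) w)) θ =
        L (1, 0) + (v₁ 0 • L (0, e₀) + v₁ 1 • L (0, e₁)) := by
      rw [hGdef, ν.deriv_coordMap_curve (R.hasDerivAt_lin_circlePoint θ w), ← hGdef, ← hu, ← hw', ← hL,
        ← hv₁, clm_zero_prod_decomp]
    have hline : ∀ i : Fin 2,
        (fun r : ℝ ↦ G (θ, R.lin u (w + EuclideanSpace.single i r))) =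
        fun r ↦ G (θ, w' + r • R.lin u (EuclideanSpace.single i (1 : ℝ))) := by
      intro i
      funext r
      rw [R.lin_add, euclideanSpace_single_eq_smul i r, R.lin_smul]
    have h2 : deriv (fun r : ℝ ↦ G (θ, R.lin u (w + EuclideanSpace.single 0 r))) 0 =
        R.a u • L (0, e₀) + R.c u • L (0, e₁) := by
      rw [hline 0, hGdef, deriv_coordMap_line, ← hGdef, ← hL, clm_zero_prod_decomp]
      simp [he₀, he₁]
    have h3 : deriv (fun r : ℝ ↦ G (θ, R.lin u (w + EuclideanSpace.single 1 r))) 0 =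
        R.b u • L (0, e₀) + R.d u • L (0, e₁) := by
      rw [hline 1, hGdef, deriv_coordMap_line, ← hGdef, ← hL, clm_zero_prod_decomp]
      simp [he₀, he₁]
    -- rewrite the goal through the coordinate expression `G`
    change 0 < frameDet (G (θ, R.lin (circlePoint θ) w))
      (deriv (fun t : ℝ ↦ G (t, R.lin (circlePoint t) w)) θ)
      (deriv (fun r : ℝ ↦ G (θ, R.lin (circlePoint θ) (w + EuclideanSpace.single 0 r))) 0)
      (deriv (fun r : ℝ ↦ G (θ, R.lin (circlePoint θ) (w + EuclideanSpace.single 1 r))) 0)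
    rw [← hu, ← hw', h1, h2, h3, frameDet_comb₂, frameDet_row_add]
    have hdet : 0 < R.a u * R.d u - R.c u * R.b u := by
      have h := R.det_pos u
      rwa [mul_comm (R.b u)] at h
    exact mul_pos hdet (ν.tubeFrameDet_coordMap_pos θ w')

/-- The reframed tubular neighbourhood on points. [folklore] -/
@[simp] theorem reframe_apply (p : (𝕊 1) × 𝔼 2) : ν.reframe R p = ν (p.1, R.lin p.1 p.2) := rfl

/-- **Reframing does not change the image** of the tubular neighbourhood. [folklore] -/
theorem range_reframe : range ⇑(ν.reframe R) = range ⇑ν := by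
  have : ⇑(ν.reframe R) = ⇑ν ∘ R.diffeo := by funext p; rfl
  rw [this, (EquivLike.surjective R.diffeo).range_comp]

/-- **The fibre derivative of the reframed neighbourhood** is the fibre derivative of `ν` composed
with the linear reframing: `D_w (ν.reframe R (u, ·)) (w) v = D_w ν(u, ·) (R.lin u w) (R.lin u v)`.
[folklore] -/
theorem fderiv_reframe_fibre (u : 𝕊 1) (w v : 𝔼 2) :
    fderiv ℝ (fun w' : 𝔼 2 ↦ ((ν.reframe R (u, w') : 𝕊 3) : 𝔼 4)) w v =
      fderiv ℝ (fun w' : 𝔼 2 ↦ ((ν (u, w') : 𝕊 3) : 𝔼 4)) (R.lin u w) (R.lin u v) := by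
  have hcomp : (fun w' : 𝔼 2 ↦ ((ν.reframe R (u, w') : 𝕊 3) : 𝔼 4)) =
      (fun w' : 𝔼 2 ↦ ((ν (u, w') : 𝕊 3) : 𝔼 4)) ∘ R.linCLM u := by
    funext w'; rfl
  have hν : DifferentiableAt ℝ (fun w' : 𝔼 2 ↦ ((ν (u, w') : 𝕊 3) : 𝔼 4)) (R.linCLM u w) :=
    ((ν.contDiff_coe_fibre u).differentiable (by simp)) _
  rw [hcomp, fderiv_comp w hν (R.linCLM u).differentiableAt, (R.linCLM u).fderiv]
  rfl

/-- In particular along the zero section: `D_w|₀ (ν.reframe R (u, ·)) v = D_w|₀ ν(u, ·) (R.lin u v)`.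
[folklore] -/
theorem fderiv_reframe_fibre_zero (u : 𝕊 1) (v : 𝔼 2) :
    fderiv ℝ (fun w' : 𝔼 2 ↦ ((ν.reframe R (u, w') : 𝕊 3) : 𝔼 4)) 0 v =
      fderiv ℝ (fun w' : 𝔼 2 ↦ ((ν (u, w') : 𝕊 3) : 𝔼 4)) 0 (R.lin u v) := by
  rw [fderiv_reframe_fibre, R.lin_zero]

end Knot.TubularNbhd

end Literature.Topology.FourManifolds
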